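import Literature.AlgebraicGeometry.HodgeTheory.RealMultiplicationRelDimThreePowersHodgeClasses
import Literature.AlgebraicGeometry.HodgeTheory.StablyNondegenerateTypeIIRankThree
import HarnessLib

/-!
# Abelian SIXFOLDS with real or quaternion multiplication: `B•(Aⁿ) = D•(Aⁿ)` for all `n` and the Hodge conjecture for all powers of (i) every abelian sixfold whose endomorphism algebra is a totally real field `F ≠ ℚ`, (ii) every simple abelian sixfold whose endomorphism algebra is a totally indefinite quaternion algebra over a totally real field — UNCONDITIONAL (the atlas rows `g6.I(2)`, `g6.I(3)`, `g6.I(6)`, `g6.II(1)`, `g6.II(3)` in two statements)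

Family `hodge`, layer `Literature/AlgebraicGeometry/HodgeTheory`. Research context: cell `pub-hodge-ring2` (HONEST FRAMING:
research route conditional on HC_CM; not a corollary; Q11.4-sentence-2 already refuted in dim ≥ 3), Literature lane gen 82,
consolidation of programmes R59 (Ribet in relative dimension three) and R60 (type II of quaternion rank three) with the tree's
relative dimensions one and two (`RealSl2Blocks`/`StablyNondegenerateProducts`, `StablyNondegenerateRelDimTwo`) and quaternion
ranks one and two (`TypeIIMinimalAlbertPowersHodgeClasses`). THEOREMS ONLY (no definition, no named fact; D-0026); UNCONDITIONAL.

THE ARITHMETIC. (i) For `End⁰(A) = F` a totally real field, `[F:ℚ] ∣ dim A` (§1: every real eigenblock `V_τ ⊆ H¹ ⊗ ℂ` of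
`F` is even-dimensional — it carries a non-degenerate alternating form, Deligne's adapted symplectic basis — and
`dim V_τ · [F:ℚ] = 2 dim A`); so for `dim A = 6`, `[F:ℚ] ∈ {1, 2, 3, 6}`, of relative dimension `6, 3, 2, 1`; the last
three are the tree's theorems (Ribet 1983 Thm. 0 for `1`; Thm. 1 / Gordon 6.3 for `3`, programme R59; Moonen–Zarhin / Murty
/ B–G–K `h = 2` for `2`), the first (`End⁰ = ℚ`, `Hg = Sp₁₂`) is NOT used here (hypothesis `[F:ℚ] ≠ 1`). (ii) For `End⁰(A) = D`
quaternion over `K`, `[D:ℚ] = 4[K:ℚ] ∣ 2 dim A = 12` (the tree's `finrank_endAlgebra_dvd_two_mul_dim`), so `[K:ℚ] ∈ {1, 3}`,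
of quaternion rank `3` (programme R60, `TypeIIRankThreePowersHodgeClasses`) or `1` (`TypeIIMinimalAlbertPowersHodgeClasses`).
Murty (Gordon's survey Thm. 7.2, held `paper:arxiv-alg-geom_9709030` p. 20; `m ∈ {1, 3}` odd) and B–G–K 2006 Cor. 7.19 /
Thm. 7.34 (`h` odd) with the even cases `h = 2` of the tree.

* §1 `HodgeStructure.even_finrank_eigenBlock_of_real_characters`, **`AbelianVariety.finrank_endAlgebra_dvd_dim_of_isTotallyReal_endField`**.
* §2 **`isStablyNondegenerate_of_sixfold_isTotallyReal_endField`** (`dim A = 6`, `End⁰(A)` a totally real field of degree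
  `≠ 1`), HC for all powers and everything isogenous, products with any stably nondegenerate variety.
* §3 **`isStablyNondegenerate_of_isSimple_sixfold_isTotallyIndefinite`** (`A` simple, `dim A = 6`, `End⁰(A)` a totally
  indefinite quaternion algebra over a totally real `K`, any `K`), HC for all powers and everything isogenous, products.

## References

* [Ribet1983] K. A. Ribet, Amer. J. Math. 105 (1983), Thms. 0–1. [cite: Ribet1983, Thms. 0 and 1]
* [Gordon1997] B. B. Gordon, arXiv:alg-geom/9709030, Thm. 6.3, Thm. 7.2. [cite: Gordon1997, Thm. 7.2 (arXiv:alg-geom/9709030 p. 20)]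
* [BanaszakGajdaKrason2006] G. Banaszak, W. Gajda, P. Krasoń, Doc. Math. Extra Vol. Coates (2006), Cor. 7.19, Thm. 7.34.
  [cite: BanaszakGajdaKrason2006, Cor. 7.19 and Thm. 7.34]
* [MoonenZarhin1995Duke] B. Moonen, Yu. Zarhin, Duke Math. J. 77 (1995), Types I(2), II. [cite: MoonenZarhin1995Duke, Type II]
* [Murty1984] V. K. Murty, Math. Ann. 268 (1984), Thm. 3.1, §3. [cite: Murty1984, Thm. 3.1 and §3]
* [Hazama1989] F. Hazama, Duke Math. J. 58 (1989). [cite: Hazama1989, Thm. (= Gordon 7.6.2)]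
* [Deligne1982HodgeCycles] P. Deligne, LNM 900 (1982), §4 proof of Cor. 4.2. [cite: Deligne1982HodgeCycles, §4 proof of Cor. 4.2]
* [Milne1999LefschetzClasses] J. S. Milne, Duke Math. J. 96 (1999), §3 Prop. 3.6. [cite: Milne1999LefschetzClasses, §3 Prop. 3.6 (c) and p. 658]
* [Shimura1963AnalyticFamilies] G. Shimura, Ann. of Math. 78 (1963), §4 Prop. 14–15. [cite: Shimura1963AnalyticFamilies, §4]
* [MumfordAV1970] D. Mumford, *Abelian Varieties* (1970), §19 Cor. of Thm. 3, §21. [cite: MumfordAV1970, §19 Cor. 2 of Thm. 1 (p. 174)]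
* [vanGeemen1994HodgeAV] B. van Geemen, LNM 1594 (1994), Lemma 3.7. [cite: vanGeemen1994HodgeAV, Lemma 3.7]
* [Deligne2000] P. Deligne, *The Hodge conjecture* (Clay, 2000), §1. [cite: Deligne2000, §1]
-/

noncomputable section

open scoped TensorProduct
open CategoryTheory Module NumberField

/-! ### §1 Real eigenblocks are even-dimensional; `[F:ℚ] ∣ dim A` for real multiplication by `F` -/

namespace Literature.AlgebraicGeometry.Motives

namespace HodgeStructure

universe u

variable {V : Type u} [AddCommGroup V] [Module ℚ V] [Module.Finite ℚ V] [HodgeTensorFacts.{u, u}] {n : ℤ}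
variable {ι : Type*} [DecidableEq ι]

/-- **The eigenblocks of real characters are even-dimensional.** For an effective polarized weight-one `ℚ`-Hodge structure
all of whose Hodge endomorphisms are `ψ`-self-adjoint and real characters `σ_i` of `End_Hdg` whose eigenblocks `T_i` form an
internal direct sum, `dim T_i` is even: `ψ_ℂ|_{T_i}` is alternating and non-degenerate and `Θ|_{T_i}` is an anti-isometric
involution, so Deligne's construction (the tree's `Milne1999.exists_adapted_symplecticBasis`) gives a basis indexed by
`Fin m ⊕ Fin m`. [cite: Deligne1982HodgeCycles, §4 proof of Cor. 4.2] [cite: Milne1999LefschetzClasses, §3 Prop. 3.6 (c) and p. 658] -/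
theorem even_finrank_eigenBlock_of_real_characters (H : HodgeStructure V n) (hn : n = 1) (heff : H.IsEffective)
    (ψ : H.Polarization)
    (hself : ∀ a : H.endAlg, LinearMap.IsAdjointPair ψ.form ψ.form (a : Module.End ℚ V) (a : Module.End ℚ V))
    (σ : ι → (H.endAlg →+* ℂ)) (hint : DirectSum.IsInternal fun i => H.eigenBlock (σ i)) (i : ι) :
    Even (Module.finrank ℂ (H.eigenBlock (σ i))) := by
  classical
  subst hn
  obtain ⟨Θ, hΘ⟩ := exists_hodgeTheta H
  obtain ⟨-, -, -, -, hΘΘ⟩ := UnitaryTheta.theta_facts H rfl heff hΘ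
  have hΘC : Θ ∈ H.hodgeLieC := H.mem_hodgeLieC_of_forall_piece hΘ
  have hodd : Odd (1 : ℤ) := ⟨0, by norm_num⟩
  set T := H.eigenBlock (σ i) with hT
  have hΘT : ∀ x ∈ T, Θ x ∈ T := fun x hx => H.apply_mem_eigenBlock_of_mem_hodgeLieC hΘC hx
  set B : LinearMap.BilinForm ℂ T := (ψ.form.baseChange ℂ).compl₁₂ T.subtype T.subtype with hB
  have hBapply : ∀ x y : T, B x y = ψ.form.baseChange ℂ (x : ℂ ⊗[ℚ] V) (y : ℂ ⊗[ℚ] V) := fun x y => rfl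
  set J : Module.End ℂ T := Θ.restrict hΘT with hJ
  have hJapply : ∀ x : T, ((J x : T) : ℂ ⊗[ℚ] V) = Θ x := fun x => rfl
  have hBalt : B.IsAlt := fun x => by
    change B x x = 0
    rw [hBapply]
    exact form_baseChange_self_eq_zero_of_odd H hodd ψ _
  have hleft : B.SeparatingLeft := fun x hx =>
    Subtype.ext (SymplecticBlocks.eq_zero_of_forall_block H ψ hself σ hint i x.2 fun y hy => by
      have h := hx ⟨y, hy⟩
      rwa [hBapply] at h)
  have hBnd : B.Nondegenerate := by
    refine ⟨hleft, fun y hy => hleft y fun x => ?_⟩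
    rw [hBapply, form_baseChange_swap_of_odd H hodd ψ, ← hBapply, hy x, neg_zero]
  have hJJ : ∀ x, J (J x) = ((1 : ℂ) ^ 2) • x := fun x => Subtype.ext (by
    rw [one_pow, one_smul, hJapply, hJapply, hΘΘ])
  have hJB : ∀ x y, B (J x) (J y) = -((1 : ℂ) ^ 2) * B x y := fun x y => by
    rw [hBapply, hBapply, hJapply, hJapply, formBaseChange_skew_of_mem_hodgeLieC ψ hΘC, hΘΘ]
    ring
  obtain ⟨m, b₁, -⟩ :=
    Literature.AlgebraicGeometry.Milne1999.exists_adapted_symplecticBasis B hBalt hBnd J one_ne_zero hJJ hJB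
  exact ⟨m, by rw [Module.finrank_eq_card_basis b₁, Fintype.card_sum, Fintype.card_fin]⟩

end HodgeStructure

end Literature.AlgebraicGeometry.Motives

namespace Literature.AlgebraicGeometry.HodgeTheory

open Literature.AlgebraicTopology.SingularHomology
open Literature.AlgebraicGeometry.Motives (IsSmoothProjective AbelianVariety bettiCohomology HodgeTensorFacts
  hodgeTensorFacts_holds)
open Literature.Barriers.HodgeConjecture
open Literature.AlgebraicGeometry.Motives.HodgeStructure
open Literature.AlgebraicGeometry.ComplexMultiplication
open Literature.AlgebraicGeometry.Milne1999
open Literature.RingTheory.CentralSimple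
open Literature.NumberTheory.Automorphic (IsQuaternionAlgebra)

section TypeI

variable {A : AbelianVariety ℂ}

variable (A) in
/-- **`[F:ℚ] ∣ dim A` when `End⁰(A) = F` is a totally real field** (type I: `H¹(A, ℚ)` is free over `F` of EVEN rank
`2 dim A/[F:ℚ]` — Mumford §19, Shimura §4; here: the real eigenblock `V_τ` of an embedding `τ : F → ℂ` satisfies
`dim V_τ · [F:ℚ] = dim H¹ = 2 dim A` (the tree's `EndFieldAction.finrank_iInf_eigenspace_mul_finrank`) and `dim V_τ` is even
(§1)). [cite: MumfordAV1970, §19 Cor. 2 of Thm. 1 (p. 174)] [cite: Shimura1963AnalyticFamilies, §4]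
[cite: Deligne1982HodgeCycles, §4 proof of Cor. 4.2] -/
theorem AbelianVariety.finrank_endAlgebra_dvd_dim_of_isTotallyReal_endField (hF : IsField A.endAlgebra)
    [IsTotallyReal (EndField A hF)] : Module.finrank ℚ A.endAlgebra ∣ A.dim := by
  classical
  have hHD : exists_isReal_hodgeModel := exists_isReal_hodgeModel_holds
  have hI : hodgePQ_independent_of_hodgeModel := hodgePQ_independent_of_hodgeModel_holds
  haveI : HodgeTensorFacts.{0, 0} := hodgeTensorFacts_holds.{0, 0}
  haveI : Module.Finite ℚ (bettiCohomology A.X 1) := finite_bettiCohomology_one A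
  have hX : IsSmoothProjective A.dim A.X := AbelianVariety.isSmoothProjective_holds
  obtain ⟨ψ⟩ : (BettiUniverse.hodge hHD (AbelianVariety.isSmoothProjective_holds (A := A)) 1).IsPolarizable :=
    smoothProjective_hodgeStructure_isPolarizable_holds hX (BettiUniverse.realHodgeModel hHD hX)
      (BettiUniverse.realHodgeModel_isHodgeSymmetric hHD hX) 1
  obtain ⟨τ⟩ : Nonempty (EndField A hF →+* ℂ) := inferInstance
  have hself := isAdjointPair_self_of_real_characters
    (BettiUniverse.hodge hHD (AbelianVariety.isSmoothProjective_holds (A := A)) 1) (by norm_num)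
    (BettiUniverse.hodge_isEffective hHD hX 1) ψ (hodgeCharacter hF hHD hI) (hodgeCharacter_isReal hF hHD hI)
    (isInternal_eigenBlock_hodgeCharacter hF hHD hI)
  obtain ⟨m, hm⟩ := even_finrank_eigenBlock_of_real_characters
    (BettiUniverse.hodge hHD (AbelianVariety.isSmoothProjective_holds (A := A)) 1) (by norm_num)
    (BettiUniverse.hodge_isEffective hHD hX 1) ψ hself (hodgeCharacter hF hHD hI)
    (isInternal_eigenBlock_hodgeCharacter hF hHD hI) τ
  have h : Module.finrank ℂ ↥(⨅ e : EndField A hF, Module.End.eigenspace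
      ((hOneAlgHom (EndField.toEndAlgebra hF).toRingHom e).baseChange ℂ) (τ e)) *
      Module.finrank ℚ (EndField A hF) = Module.finrank ℚ (bettiCohomology A.X 1) :=
    (hOneEndAction (EndField.toEndAlgebra hF).toRingHom hHD hI (A := A)).finrank_iInf_eigenspace_mul_finrank τ
  rw [← eigenBlock_hodgeCharacter hF hHD hI τ, hm, finrank_bettiCohomology_one, EndField.finrank_eq] at h
  exact ⟨m, by linarith⟩

variable (A) in
/-- **Every abelian SIXFOLD whose endomorphism algebra is a totally real field `F ≠ ℚ` is stably nondegenerate —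
UNCONDITIONAL**: `[F:ℚ] ∈ {2, 3, 6}` (§1), i.e. relative dimension `3` (Ribet 1983 Thm. 1 / Gordon 6.3, the tree's
`isStablyNondegenerate_of_isTotallyReal_of_three_mul_finrank_eq`, programme R59), `2` (the tree's
`isStablyNondegenerate_of_isTotallyReal_of_two_mul_finrank_eq`) or `1` (Ribet Thm. 0, the tree's
`isStablyNondegenerate_of_isTotallyReal`). (`F = ℚ`, `Hg = Sp₁₂`, is not covered.) [cite: Ribet1983, Thms. 0 and 1]
[cite: Gordon1997, Thm. 7.2 (arXiv:alg-geom/9709030 p. 20)] [cite: MoonenZarhin1995Duke, Type II] -/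
theorem isStablyNondegenerate_of_sixfold_isTotallyReal_endField (h6 : A.dim = 6) (hF : IsField A.endAlgebra)
    [IsTotallyReal (EndField A hF)] (hne : Module.finrank ℚ A.endAlgebra ≠ 1) : IsStablyNondegenerate A := by
  have hdvd := AbelianVariety.finrank_endAlgebra_dvd_dim_of_isTotallyReal_endField A hF
  rw [h6] at hdvd
  have hle : Module.finrank ℚ A.endAlgebra ≤ 6 := Nat.le_of_dvd (by norm_num) hdvd
  interval_cases he : Module.finrank ℚ A.endAlgebra
  · exact absurd hdvd (by decide)
  · exact absurd rfl hne
  · exact isStablyNondegenerate_of_isTotallyReal_of_three_mul_finrank_eq A hF (by rw [h6, he])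
  · exact isStablyNondegenerate_of_isTotallyReal_of_two_mul_finrank_eq A hF (by rw [h6, he])
  · exact absurd hdvd (by decide)
  · exact absurd hdvd (by decide)
  · exact isStablyNondegenerate_of_isTotallyReal A hF (by rw [h6, he])

variable (A) in
/-- **`B•(Aⁿ⁺¹) = D•(Aⁿ⁺¹) ⊗ ℂ` for every abelian sixfold with real multiplication by a totally real field `F ≠ ℚ`.**
[cite: Ribet1983, Thms. 0 and 1] [cite: Gordon1997, Thm. 7.2 (arXiv:alg-geom/9709030 p. 20)] -/
theorem AbelianVariety.isDivisorGenerated_powSucc_of_sixfold_isTotallyReal_endField (h6 : A.dim = 6)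
    (hF : IsField A.endAlgebra) [IsTotallyReal (EndField A hF)] (hne : Module.finrank ℚ A.endAlgebra ≠ 1) (N : ℕ) :
    IsDivisorGenerated (A.powSucc N) :=
  isStablyNondegenerate_of_sixfold_isTotallyReal_endField A h6 hF hne N

/-- **The Hodge conjecture for all powers of every abelian sixfold with real multiplication by a totally real field
`F ≠ ℚ` — UNCONDITIONAL.** [cite: Ribet1983, Thms. 0 and 1] [cite: Gordon1997, Thm. 7.2 (arXiv:alg-geom/9709030 p. 20)]
[cite: Deligne2000, §1] -/
theorem hodgeConjectureFor_powSucc_of_sixfold_isTotallyReal_endField (h6 : A.dim = 6) (hF : IsField A.endAlgebra)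
    [IsTotallyReal (EndField A hF)] (hne : Module.finrank ℚ A.endAlgebra ≠ 1) (N : ℕ) :
    HodgeConjectureFor (A.powSucc N).dim (A.powSucc N).X :=
  (isStablyNondegenerate_of_sixfold_isTotallyReal_endField A h6 hF hne).hodgeConjectureFor_powSucc N

/-- The sixfold itself. [cite: Ribet1983, Thms. 0 and 1] [cite: Deligne2000, §1] -/
theorem hodgeConjectureFor_of_sixfold_isTotallyReal_endField (h6 : A.dim = 6) (hF : IsField A.endAlgebra)
    [IsTotallyReal (EndField A hF)] (hne : Module.finrank ℚ A.endAlgebra ≠ 1) : HodgeConjectureFor A.dim A.X :=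
  (isStablyNondegenerate_of_sixfold_isTotallyReal_endField A h6 hF hne).hodgeConjectureFor

/-- Everything isogenous to a power `A^{N+1}`. [cite: vanGeemen1994HodgeAV, Lemma 3.7] [cite: Ribet1983, Thms. 0 and 1] -/
theorem hodgeConjectureFor_of_isIsogenous_powSucc_of_sixfold_isTotallyReal_endField (h6 : A.dim = 6)
    (hF : IsField A.endAlgebra) [IsTotallyReal (EndField A hF)] (hne : Module.finrank ℚ A.endAlgebra ≠ 1)
    {X : AbelianVariety ℂ} {N : ℕ} (hX : AbelianVariety.IsIsogenous X (A.powSucc N)) : HodgeConjectureFor X.dim X.X :=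
  (isStablyNondegenerate_of_sixfold_isTotallyReal_endField A h6 hF hne).hodgeConjectureFor_of_isIsogenous_powSucc hX

/-- **ANY stably nondegenerate variety times such a sixfold is stably nondegenerate** (Hazama's theorem for a type I
factor, the tree's `IsStablyNondegenerate.prod_of_isTotallyReal_endField_right`). [cite: Hazama1989, Thm. (= Gordon 7.6.2)]
[cite: Ribet1983, Thms. 0 and 1] -/
theorem IsStablyNondegenerate.prod_sixfold_isTotallyReal_endField {B : AbelianVariety ℂ} (hB : IsStablyNondegenerate B)
    (h6 : A.dim = 6) (hF : IsField A.endAlgebra) [IsTotallyReal (EndField A hF)]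
    (hne : Module.finrank ℚ A.endAlgebra ≠ 1) : IsStablyNondegenerate (B.prod A) :=
  hB.prod_of_isTotallyReal_endField_right (isStablyNondegenerate_of_sixfold_isTotallyReal_endField A h6 hF hne) hF

/-- HC for everything isogenous to a power of `B^{M+1} × A^{N+1}`, `B` stably nondegenerate, `A` such a sixfold — UNCONDITIONAL.
[cite: Hazama1989, Thm. (= Gordon 7.6.2)] [cite: vanGeemen1994HodgeAV, Lemma 3.7] -/
theorem hodgeConjectureFor_of_isIsogenous_powSucc_powSucc_prod_powSucc_sixfold_isTotallyReal_endField
    {B : AbelianVariety ℂ} (hB : IsStablyNondegenerate B) (h6 : A.dim = 6) (hF : IsField A.endAlgebra)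
    [IsTotallyReal (EndField A hF)] (hne : Module.finrank ℚ A.endAlgebra ≠ 1) {X : AbelianVariety ℂ} {M N L : ℕ}
    (hX : AbelianVariety.IsIsogenous X (((B.powSucc M).prod (A.powSucc N)).powSucc L)) : HodgeConjectureFor X.dim X.X :=
  ((hB.prod_sixfold_isTotallyReal_endField h6 hF hne).powSucc_prod_powSucc M N).hodgeConjectureFor_of_isIsogenous_powSucc hX

end TypeI

section TypeII

variable {A : AbelianVariety ℂ} {K : Type} [Field K] [NumberField K] [Algebra K A.endAlgebra]
  [IsScalarTower ℚ K A.endAlgebra] [IsQuaternionAlgebra K A.endAlgebra]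

variable (A) in
/-- **Every SIMPLE abelian SIXFOLD whose endomorphism algebra is a totally indefinite quaternion algebra over a totally
real field `K` is stably nondegenerate — UNCONDITIONAL**: `4[K:ℚ] = [D:ℚ] ∣ 2 dim A = 12` (the tree's
`finrank_endAlgebra_dvd_two_mul_dim`), so `[K:ℚ] = 1` (quaternion rank three, programme R60:
`isStablyNondegenerate_of_isSimple_isTotallyIndefinite_rankThree`) or `[K:ℚ] = 3` (quaternion rank one, the tree's
`AbelianVariety.isDivisorGenerated_powSucc_of_isSimple_isTotallyIndefinite`). [cite: Gordon1997, Thm. 7.2 (arXiv:alg-geom/9709030 p. 20)]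
[cite: BanaszakGajdaKrason2006, Cor. 7.19 and Thm. 7.34] [cite: MumfordAV1970, §19 Cor. 2 of Thm. 1 (p. 174)] -/
theorem isStablyNondegenerate_of_isSimple_sixfold_isTotallyIndefinite [IsTotallyReal K] (hA : A.IsSimple)
    (hind : IsTotallyIndefinite K A.endAlgebra) (h6 : A.dim = 6) : IsStablyNondegenerate A := by
  -- `[D:ℚ] = 4[K:ℚ]` through a real splitting `ℝ ⊗ D ≅ ∏_{places of K} M₂(ℝ)`
  obtain ⟨Φ⟩ := nonempty_realSplitting_of_isSimple_isTotallyIndefinite hA hind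
  have h4 : Module.finrank ℚ A.endAlgebra = Module.finrank ℚ K * 4 := by
    rw [RealSplitting.finrank_eq_four_mul_card Φ, card_infinitePlace_eq_finrank_of_isTotallyReal K, mul_comm]
  have hdvd := finrank_endAlgebra_dvd_two_mul_dim hA
  rw [h4, h6, show 2 * 6 = 3 * 4 from rfl] at hdvd
  have hdvd3 : Module.finrank ℚ K ∣ 3 := Nat.dvd_of_mul_dvd_mul_right (by norm_num) hdvd
  have hle : Module.finrank ℚ K ≤ 3 := Nat.le_of_dvd (by norm_num) hdvd3
  have hpos : 0 < Module.finrank ℚ K := Module.finrank_pos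
  interval_cases he : Module.finrank ℚ K
  · exact isStablyNondegenerate_of_isSimple_isTotallyIndefinite_rankThree A hA hind (by rw [h6, he])
  · exact absurd hdvd3 (by decide)
  · exact fun N => AbelianVariety.isDivisorGenerated_powSucc_of_isSimple_isTotallyIndefinite A hA hind (by rw [h6, he]) N

variable (A) in
/-- All powers `A^{M+1}` are stably nondegenerate. [cite: Gordon1997, Thm. 7.2 (arXiv:alg-geom/9709030 p. 20)] [cite: Gordon1999HodgeAVSurvey, Rem. 7.6.1] -/
theorem isStablyNondegenerate_powSucc_of_isSimple_sixfold_isTotallyIndefinite [IsTotallyReal K] (hA : A.IsSimple)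
    (hind : IsTotallyIndefinite K A.endAlgebra) (h6 : A.dim = 6) (M : ℕ) : IsStablyNondegenerate (A.powSucc M) :=
  (isStablyNondegenerate_of_isSimple_sixfold_isTotallyIndefinite A hA hind h6).powSucc M

variable (A) in
/-- **`B•(Aⁿ⁺¹) = D•(Aⁿ⁺¹) ⊗ ℂ` for every simple abelian sixfold with totally indefinite quaternion multiplication.**
[cite: Gordon1997, Thm. 7.2 (arXiv:alg-geom/9709030 p. 20)] [cite: BanaszakGajdaKrason2006, Cor. 7.19 and Thm. 7.34] -/
theorem AbelianVariety.isDivisorGenerated_powSucc_of_isSimple_sixfold_isTotallyIndefinite [IsTotallyReal K]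
    (hA : A.IsSimple) (hind : IsTotallyIndefinite K A.endAlgebra) (h6 : A.dim = 6) (N : ℕ) :
    IsDivisorGenerated (A.powSucc N) :=
  isStablyNondegenerate_of_isSimple_sixfold_isTotallyIndefinite A hA hind h6 N

/-- **The Hodge conjecture for all powers of every simple abelian sixfold with totally indefinite quaternion
multiplication — UNCONDITIONAL.** [cite: Gordon1997, Thm. 7.2 (arXiv:alg-geom/9709030 p. 20)]
[cite: BanaszakGajdaKrason2006, Cor. 7.19 and Thm. 7.34] [cite: Deligne2000, §1] -/
theorem hodgeConjectureFor_powSucc_of_isSimple_sixfold_isTotallyIndefinite [IsTotallyReal K] (hA : A.IsSimple)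
    (hind : IsTotallyIndefinite K A.endAlgebra) (h6 : A.dim = 6) (N : ℕ) :
    HodgeConjectureFor (A.powSucc N).dim (A.powSucc N).X :=
  (isStablyNondegenerate_of_isSimple_sixfold_isTotallyIndefinite A hA hind h6).hodgeConjectureFor_powSucc N

/-- The sixfold itself. [cite: Gordon1997, Thm. 7.2 (arXiv:alg-geom/9709030 p. 20)] [cite: Deligne2000, §1] -/
theorem hodgeConjectureFor_of_isSimple_sixfold_isTotallyIndefinite [IsTotallyReal K] (hA : A.IsSimple)
    (hind : IsTotallyIndefinite K A.endAlgebra) (h6 : A.dim = 6) : HodgeConjectureFor A.dim A.X :=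
  (isStablyNondegenerate_of_isSimple_sixfold_isTotallyIndefinite A hA hind h6).hodgeConjectureFor

/-- Everything isogenous to a power `A^{N+1}`. [cite: vanGeemen1994HodgeAV, Lemma 3.7] [cite: Gordon1997, Thm. 7.2 (arXiv:alg-geom/9709030 p. 20)] -/
theorem hodgeConjectureFor_of_isIsogenous_powSucc_of_isSimple_sixfold_isTotallyIndefinite [IsTotallyReal K]
    (hA : A.IsSimple) (hind : IsTotallyIndefinite K A.endAlgebra) (h6 : A.dim = 6) {X : AbelianVariety ℂ} {N : ℕ}
    (hX : AbelianVariety.IsIsogenous X (A.powSucc N)) : HodgeConjectureFor X.dim X.X :=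
  (isStablyNondegenerate_of_isSimple_sixfold_isTotallyIndefinite A hA hind h6).hodgeConjectureFor_of_isIsogenous_powSucc hX

/-- **ANY stably nondegenerate variety times such a sixfold is stably nondegenerate** (Hazama's theorem for a type II
factor, the tree's `IsStablyNondegenerate.prod_of_isSimple_isTotallyIndefinite_right`). [cite: Hazama1989, Thm. (= Gordon 7.6.2)]
[cite: Gordon1997, Thm. 7.2 (arXiv:alg-geom/9709030 p. 20)] -/
theorem IsStablyNondegenerate.prod_isSimple_sixfold_isTotallyIndefinite [IsTotallyReal K] {B : AbelianVariety ℂ}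
    (hB : IsStablyNondegenerate B) (hA : A.IsSimple) (hind : IsTotallyIndefinite K A.endAlgebra) (h6 : A.dim = 6) :
    IsStablyNondegenerate (B.prod A) :=
  hB.prod_of_isSimple_isTotallyIndefinite_right (isStablyNondegenerate_of_isSimple_sixfold_isTotallyIndefinite A hA hind h6)
    hA hind

/-- HC for everything isogenous to a power of `B^{M+1} × A^{N+1}`, `B` stably nondegenerate, `A` such a sixfold — UNCONDITIONAL.
[cite: Hazama1989, Thm. (= Gordon 7.6.2)] [cite: vanGeemen1994HodgeAV, Lemma 3.7] -/
theorem hodgeConjectureFor_of_isIsogenous_powSucc_powSucc_prod_powSucc_isSimple_sixfold_isTotallyIndefinite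
    [IsTotallyReal K] {B : AbelianVariety ℂ} (hB : IsStablyNondegenerate B) (hA : A.IsSimple)
    (hind : IsTotallyIndefinite K A.endAlgebra) (h6 : A.dim = 6) {X : AbelianVariety ℂ} {M N L : ℕ}
    (hX : AbelianVariety.IsIsogenous X (((B.powSucc M).prod (A.powSucc N)).powSucc L)) : HodgeConjectureFor X.dim X.X :=
  ((hB.prod_isSimple_sixfold_isTotallyIndefinite hA hind h6).powSucc_prod_powSucc M N).hodgeConjectureFor_of_isIsogenous_powSucc
    hX

end TypeII

end Literature.AlgebraicGeometry.HodgeTheory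

end
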